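import Literature.Probability.Percolation.TwoSetConditionalAssociationRCSplitVertex
import HarnessLib

/-!
# `NoHeavyLowerTail` (stmt-CriticalPhenomena-4575) — the pendant-path gadget: a wired apex block as a free measure on a larger graph

Support file (prover prim-gen-kcluster gen 56; `--supports stmt-CriticalPhenomena-4575`).  No named facts, no sorries,
no definitions of mathematical objects beyond the explicit gadget (weights on `Sym2 (V ⊕ Z)`).

WHAT.  For a finite vertex type `V`, pair parameters `w ∈ [0,1]^{Sym2 V}`, a vertex `a` and an attachment map
`att : Z → V` (finite `Z`), put on `V ⊕ Z` the parameters `w†`: the old pairs keep `w`, every gadget pair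
`{inl a, inr z}` and `{inr z, inl (att z)}` gets parameter `1`, every other new pair parameter `0`.  Then the FREE
edge-parameter random-cluster measure `φ_{w†,q}` of `V ⊕ Z` is carried by the configurations `ω† = ι(ω) ∪ Γ`
(`ι` = push-forward along `inl`, `Γ` = the gadget pairs), its weight there is the weight of `ω` under the measure of `V`
WIRED on `B = {a} ∪ att(Z)` (`rcWeightW_lift`: the pendant 2-paths `a – z – att z` glue `B` into one cluster and add no
other cluster: `weight_liftCfg`, `clusterCount_liftCfg` via the explicit component equivalence `liftComponentEquiv`), and off the
lifts the free weight vanishes (`weight_eq_zero_of_ne_lift`).  The measure transfer `φ_{w†,q}(A) = φ^{B}_{w,q}(ι⁻¹ A)` and the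
connectivity-off-the-apex dictionary are in the sequel `…BHKRowApexWiredTransfer`.  This is the device by which the split-vertex two-cluster theorem of
van den Berg–Häggström–Kahn for the free measure (`…TwoSetConditionalAssociationRCSplitVertex`, valid for ALL parameters
in `[0,1]`, in particular for the parameters `1` of the gadget) transfers to the measure wired on any block containing the
split vertex — used in `…BHKRowApexWired` for the BHK row `q·T_a ≤ u_b·u_c` under `φ^B_{𝐩,q}`, `a ∈ B`.
[this work; pattern cited: Grimmett2006, §4.2 (wired boundary conditions as contraction), VandenbergHaggstromKahn2005 Thm. 1.4]
-/

noncomputable section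

namespace Summit.CriticalPhenomena.PercolationContinuityZ3.Theorems

namespace PivotalBHK

namespace ApexWired

open Literature.Probability.Percolation Literature.Probability.Percolation.BHK2006
open Literature.Probability.LatticeModels SimpleGraph
open scoped Classical

variable {V Z : Type*}

/-! ### The gadget: pairs and parameters on `V ⊕ Z` -/

/-- The gadget pairs `Γ = {{inl a, inr z}, {inl (att z), inr z} : z ∈ Z}` (the pendant 2-paths `a – z – att z`).
[this work] -/
def gadgetPairs (a : V) (att : Z → V) : Set (Sym2 (V ⊕ Z)) :=
  {e | ∃ z : Z, e = s(Sum.inl a, Sum.inr z) ∨ e = s(Sum.inl (att z), Sum.inr z)}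

/-- The lifted configuration `ι(ω) ∪ Γ`: the old pairs of `ω` pushed along `inl`, plus all gadget pairs. [this work] -/
def liftCfg (a : V) (att : Z → V) (ω : BondConfig V) : BondConfig (V ⊕ Z) :=
  Sym2.map Sum.inl '' ω ∪ gadgetPairs a att

/-- The projection of a configuration of `V ⊕ Z` to `V`: keep the old pairs. [this work] -/
def projCfg (ω' : BondConfig (V ⊕ Z)) : BondConfig V := {e | Sym2.map Sum.inl e ∈ ω'}

/-- The symmetric kernel of the gadget parameters. [this work] -/
def gadgetFun (w : Sym2 V → unitInterval) (a : V) (att : Z → V) : V ⊕ Z → V ⊕ Z → unitInterval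
  | Sum.inl u, Sum.inl v => w s(u, v)
  | Sum.inl u, Sum.inr z => if u = a ∨ u = att z then 1 else 0
  | Sum.inr z, Sum.inl u => if u = a ∨ u = att z then 1 else 0
  | Sum.inr _, Sum.inr _ => 0

/-- The kernel is symmetric. [this work] -/
theorem gadgetFun_symm (w : Sym2 V → unitInterval) (a : V) (att : Z → V) (x y : V ⊕ Z) :
    gadgetFun w a att x y = gadgetFun w a att y x := by
  cases x with
  | inl u => cases y with
    | inl v => simp only [gadgetFun, Sym2.eq_swap]
    | inr z => simp only [gadgetFun]
  | inr z => cases y with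
    | inl v => simp only [gadgetFun]
    | inr z' => simp only [gadgetFun]

/-- The gadget parameters `w†` on `Sym2 (V ⊕ Z)`: `w` on old pairs, `1` on gadget pairs, `0` elsewhere. [this work] -/
def gadgetW (w : Sym2 V → unitInterval) (a : V) (att : Z → V) : Sym2 (V ⊕ Z) → unitInterval :=
  Sym2.lift ⟨gadgetFun w a att, gadgetFun_symm w a att⟩

/-- Value of `w†` on a pair. [this work] -/
@[simp] theorem gadgetW_mk (w : Sym2 V → unitInterval) (a : V) (att : Z → V) (x y : V ⊕ Z) :
    gadgetW w a att s(x, y) = gadgetFun w a att x y := rfl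

/-! ### Membership bookkeeping -/

/-- A pushed-forward pair has two `inl` endpoints. [this work] -/
theorem map_inl_ne_gadget (e : Sym2 V) (u : V) (z : Z) : Sym2.map Sum.inl e ≠ s(Sum.inl u, Sum.inr z) := by
  intro h
  have hz : (Sum.inr z : V ⊕ Z) ∈ Sym2.map Sum.inl e := by rw [h]; exact Sym2.mem_mk_right _ _
  obtain ⟨v, -, hv⟩ := Sym2.mem_map.1 hz
  exact Sum.inl_ne_inr hv

/-- Pushed-forward pairs are not gadget pairs. [this work] -/
theorem map_inl_not_mem_gadgetPairs (a : V) (att : Z → V) (e : Sym2 V) :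
    Sym2.map Sum.inl e ∉ gadgetPairs a att := by
  rintro ⟨z, h | h⟩
  · exact map_inl_ne_gadget e a z h
  · exact map_inl_ne_gadget e (att z) z h

/-- `Sym2.map inl` is injective. [folklore] -/
theorem map_inl_injective : Function.Injective (Sym2.map (Sum.inl : V → V ⊕ Z)) :=
  Sym2.map.injective Sum.inl_injective

/-- A pushed-forward pair lies in the lift iff the pair lies in `ω`. [this work] -/
theorem map_inl_mem_liftCfg_iff (a : V) (att : Z → V) (ω : BondConfig V) (e : Sym2 V) :
    Sym2.map Sum.inl e ∈ liftCfg a att ω ↔ e ∈ ω := by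
  constructor
  · rintro (⟨e', he', hee'⟩ | h)
    · rwa [← map_inl_injective hee']
    · exact absurd h (map_inl_not_mem_gadgetPairs a att e)
  · exact fun h => Or.inl ⟨e, h, rfl⟩

/-- An `inl–inl` pair of the lift comes from `ω`. [this work] -/
theorem inl_inl_mem_liftCfg_iff (a : V) (att : Z → V) (ω : BondConfig V) (u v : V) :
    s(Sum.inl u, Sum.inl v) ∈ liftCfg a att ω ↔ s(u, v) ∈ ω := by
  rw [← map_inl_mem_liftCfg_iff a att ω s(u, v), Sym2.map_mk]

/-- An `inl–inr` pair lies in the lift iff it is a gadget pair, i.e. iff `u = a ∨ u = att z`. [this work] -/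
theorem inl_inr_mem_liftCfg_iff (a : V) (att : Z → V) (ω : BondConfig V) (u : V) (z : Z) :
    s(Sum.inl u, Sum.inr z) ∈ liftCfg a att ω ↔ (u = a ∨ u = att z) := by
  constructor
  · rintro (⟨e', -, hee'⟩ | ⟨z', h | h⟩)
    · exact absurd hee' (map_inl_ne_gadget e' u z)
    · rw [Sym2.eq_iff] at h
      rcases h with ⟨h1, h2⟩ | ⟨h1, -⟩
      · exact Or.inl (Sum.inl_injective h1)
      · exact absurd h1 Sum.inl_ne_inr
    · rw [Sym2.eq_iff] at h
      rcases h with ⟨h1, h2⟩ | ⟨h1, -⟩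
      · rw [Sum.inr_injective h2]; exact Or.inr (Sum.inl_injective h1)
      · exact absurd h1 Sum.inl_ne_inr
  · rintro (rfl | rfl)
    · exact Or.inr ⟨z, Or.inl rfl⟩
    · exact Or.inr ⟨z, Or.inr rfl⟩

/-- No `inr–inr` pair lies in the lift. [this work] -/
theorem inr_inr_not_mem_liftCfg (a : V) (att : Z → V) (ω : BondConfig V) (z z' : Z) :
    s(Sum.inr z, Sum.inr z') ∉ liftCfg a att ω := by
  rintro (⟨e', -, hee'⟩ | ⟨z'', h | h⟩)
  · have hz : (Sum.inr z : V ⊕ Z) ∈ Sym2.map Sum.inl e' := by rw [hee']; exact Sym2.mem_mk_left _ _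
    obtain ⟨v, -, hv⟩ := Sym2.mem_map.1 hz
    exact Sum.inl_ne_inr hv
  · have ha : (Sum.inl a : V ⊕ Z) ∈ s(Sum.inr z, Sum.inr z') := by rw [h]; exact Sym2.mem_mk_left _ _
    rcases Sym2.mem_iff.1 ha with h1 | h1 <;> exact Sum.inl_ne_inr h1
  · have ha : (Sum.inl (att z'') : V ⊕ Z) ∈ s(Sum.inr z, Sum.inr z') := by
      rw [h]; exact Sym2.mem_mk_left _ _
    rcases Sym2.mem_iff.1 ha with h1 | h1 <;> exact Sum.inl_ne_inr h1

/-- The projection undoes the lift. [this work] -/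
theorem projCfg_liftCfg (a : V) (att : Z → V) (ω : BondConfig V) : projCfg (liftCfg a att ω) = ω := by
  ext e
  exact map_inl_mem_liftCfg_iff a att ω e

/-- The lift is injective. [this work] -/
theorem liftCfg_injective (a : V) (att : Z → V) : Function.Injective (liftCfg a att : BondConfig V → _) :=
  fun ω₁ ω₂ h => by rw [← projCfg_liftCfg a att ω₁, h, projCfg_liftCfg]


/-! ### Weights: the free weight of the lift is the `B`-wired weight -/

section Weights

variable [Fintype V] [Fintype Z]

omit [Fintype V] [Fintype Z] in
/-- The factor of the product weight of `w†` at the lift contributed by a new pair is `1`. [this work] -/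
theorem liftCfg_factor_new (w : Sym2 V → unitInterval) (a : V) (att : Z → V) (ω : BondConfig V) (x y : V ⊕ Z)
    (hnew : ∀ u v : V, s(x, y) ≠ s(Sum.inl u, Sum.inl v)) :
    (if s(x, y) ∈ liftCfg a att ω then ((gadgetW w a att s(x, y) : unitInterval) : ℝ)
      else 1 - ((gadgetW w a att s(x, y) : unitInterval) : ℝ)) = 1 := by
  cases x with
  | inl u => cases y with
    | inl v => exact absurd rfl (hnew u v)
    | inr z =>
      by_cases h : u = a ∨ u = att z
      · rw [if_pos ((inl_inr_mem_liftCfg_iff a att ω u z).2 h), gadgetW_mk, gadgetFun, if_pos h]; rfl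
      · rw [if_neg (mt (inl_inr_mem_liftCfg_iff a att ω u z).1 h), gadgetW_mk, gadgetFun, if_neg h]; simp
  | inr z => cases y with
    | inl u =>
      rw [Sym2.eq_swap]
      by_cases h : u = a ∨ u = att z
      · rw [if_pos ((inl_inr_mem_liftCfg_iff a att ω u z).2 h), gadgetW_mk, gadgetFun, if_pos h]; rfl
      · rw [if_neg (mt (inl_inr_mem_liftCfg_iff a att ω u z).1 h), gadgetW_mk, gadgetFun, if_neg h]; simp
    | inr z' =>
      rw [if_neg (inr_inr_not_mem_liftCfg a att ω z z'), gadgetW_mk, gadgetFun]; simp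

/-- The product weight of `w†` at the lift `ι(ω) ∪ Γ` is the product weight of `w` at `ω`: the gadget pairs are open
with parameter `1`, all other new pairs closed with parameter `0`. [this work] -/
theorem weight_liftCfg (w : Sym2 V → unitInterval) (a : V) (att : Z → V) (ω : BondConfig V) :
    weight (fun e => (gadgetW w a att e : ℝ)) (liftCfg a att ω) = weight (fun e => (w e : ℝ)) ω := by
  unfold weight
  have himg : (Finset.univ.image (Sym2.map (Sum.inl : V → V ⊕ Z))) ⊆ Finset.univ := Finset.subset_univ _
  rw [← Finset.prod_subset himg, Finset.prod_image fun x _ y _ h => map_inl_injective h]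
  · refine Finset.prod_congr rfl fun e _ => ?_
    rw [map_inl_mem_liftCfg_iff]
    induction e using Sym2.inductionOn with
    | hf u v => simp only [Sym2.map_mk, gadgetW_mk, gadgetFun]
  · intro e _ he
    induction e using Sym2.inductionOn with
    | hf x y =>
      refine liftCfg_factor_new w a att ω x y fun u v h => he ?_
      exact Finset.mem_image.2 ⟨s(u, v), Finset.mem_univ _, by rw [Sym2.map_mk, h]⟩

/-- Off the lifts the free weight of `w†` vanishes: a configuration of `V ⊕ Z` that is not `ι(π ω†) ∪ Γ` has an open
parameter-`0` pair or a closed parameter-`1` pair. [this work] -/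
theorem weight_eq_zero_of_ne_lift (w : Sym2 V → unitInterval) (a : V) (att : Z → V) (ω' : BondConfig (V ⊕ Z))
    (h : ω' ≠ liftCfg a att (projCfg ω')) : weight (fun e => (gadgetW w a att e : ℝ)) ω' = 0 := by
  -- a pair where `ω'` and the lift of its projection differ
  obtain ⟨e, he⟩ : ∃ e, ¬ (e ∈ ω' ↔ e ∈ liftCfg a att (projCfg ω')) := by
    by_contra hall
    push Not at hall
    exact h (Set.ext hall)
  unfold weight
  apply Finset.prod_eq_zero (Finset.mem_univ e)
  dsimp only
  -- old pairs agree, so `e` is a new pair; there the lift is open exactly on the gadget pairs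
  have key : ∀ (u : V) (z : Z), ¬ (s(Sum.inl u, Sum.inr z) ∈ ω' ↔ s(Sum.inl u, Sum.inr z) ∈ liftCfg a att (projCfg ω')) →
      (if s(Sum.inl u, Sum.inr z) ∈ ω' then ((gadgetW w a att s(Sum.inl u, Sum.inr z) : unitInterval) : ℝ)
        else 1 - ((gadgetW w a att s(Sum.inl u, Sum.inr z) : unitInterval) : ℝ)) = 0 := by
    intro u z hne
    rw [inl_inr_mem_liftCfg_iff] at hne
    by_cases hg : u = a ∨ u = att z
    · have hin : s(Sum.inl u, Sum.inr z) ∉ ω' := fun h' => hne ⟨fun _ => hg, fun _ => h'⟩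
      rw [if_neg hin, gadgetW_mk, gadgetFun, if_pos hg]; simp
    · have hin : s(Sum.inl u, Sum.inr z) ∈ ω' := by
        by_contra h'
        exact hne ⟨fun h'' => absurd h'' h', fun h'' => absurd h'' hg⟩
      rw [if_pos hin, gadgetW_mk, gadgetFun, if_neg hg]; rfl
  induction e using Sym2.inductionOn with
  | hf x y =>
    cases x with
    | inl u => cases y with
      | inl v =>
        exact absurd ((inl_inl_mem_liftCfg_iff a att (projCfg ω') u v).trans
          (by rw [projCfg, Set.mem_setOf_eq, Sym2.map_mk])).symm he
      | inr z => exact key u z he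
    | inr z => cases y with
      | inl u =>
        rw [Sym2.eq_swap] at he ⊢
        exact key u z he
      | inr z' =>
        have hin : s(Sum.inr z, Sum.inr z') ∈ ω' := by
          by_contra h'
          exact he ⟨fun h'' => absurd h'' h', fun h'' => absurd h'' (inr_inr_not_mem_liftCfg a att _ z z')⟩
        rw [if_pos hin, gadgetW_mk, gadgetFun]; rfl

end Weights

/-! ### Cluster count: the gadget wires `B = {a} ∪ att(Z)` and adds no cluster -/

section Clusters

variable (a : V) (att : Z → V) (ω : BondConfig V)

/-- The wired block realised by the gadget: `B = {a} ∪ att(Z)`. [this work] -/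
def gadgetBlock : Set V := insert a (Set.range att)

/-- Adjacency in the free open graph of the lift. [this work] -/
theorem liftGraph_adj (x y : V ⊕ Z) :
    (openGraph (liftCfg a att ω) ⊔ wired ∅).Adj x y ↔ s(x, y) ∈ liftCfg a att ω ∧ x ≠ y := by
  rw [wired_empty, sup_bot_eq, openGraph_adj]

/-- In the lift, `inl a` reaches every `inl x`, `x ∈ B`, through the gadget. [this work] -/
theorem liftGraph_reachable_inl_of_mem {x : V} (hx : x ∈ gadgetBlock a att) :
    (openGraph (liftCfg a att ω) ⊔ wired ∅).Reachable (Sum.inl a) (Sum.inl x) := by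
  rcases hx with rfl | ⟨z, rfl⟩
  · exact Reachable.refl _
  · have h1 : (openGraph (liftCfg a att ω) ⊔ wired ∅).Adj (Sum.inl a) (Sum.inr z) :=
      (liftGraph_adj a att ω _ _).2 ⟨(inl_inr_mem_liftCfg_iff a att ω a z).2 (Or.inl rfl), Sum.inl_ne_inr⟩
    have h2 : (openGraph (liftCfg a att ω) ⊔ wired ∅).Adj (Sum.inr z) (Sum.inl (att z)) := by
      refine (liftGraph_adj a att ω _ _).2 ⟨?_, Sum.inr_ne_inl⟩
      rw [Sym2.eq_swap]
      exact (inl_inr_mem_liftCfg_iff a att ω (att z) z).2 (Or.inr rfl)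
    exact h1.reachable.trans h2.reachable

/-- Wired reachability in `V` lifts to free reachability of the `inl` vertices. [this work] -/
theorem liftGraph_reachable_of_reachable {u v : V}
    (h : (openGraph ω ⊔ wired (gadgetBlock a att)).Reachable u v) :
    (openGraph (liftCfg a att ω) ⊔ wired ∅).Reachable (Sum.inl u) (Sum.inl v) := by
  rw [reachable_iff_reflTransGen] at h
  induction h with
  | refl => exact Reachable.refl _
  | @tail x y _ hxy ih =>
    refine ih.trans ?_
    rcases (sup_adj _ _ _ _).1 hxy with h | h
    · obtain ⟨hm, hne⟩ := (openGraph_adj ω x y).1 h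
      exact Adj.reachable ((liftGraph_adj a att ω _ _).2
        ⟨(inl_inl_mem_liftCfg_iff a att ω x y).2 hm, fun h' => hne (Sum.inl_injective h')⟩)
    · obtain ⟨-, hx, hy⟩ := (wired_adj _ x y).1 h
      exact (liftGraph_reachable_inl_of_mem a att ω hx).symm.trans (liftGraph_reachable_inl_of_mem a att ω hy)

/-- The projection `V ⊕ Z → V` collapsing every gadget vertex onto `a`. [this work] -/
def projV : V ⊕ Z → V
  | Sum.inl v => v
  | Sum.inr _ => a

/-- The projection `V ⊕ Z → V` sending the gadget vertex `z` to its foot `att z`. [this work] -/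
def footV : V ⊕ Z → V
  | Sum.inl v => v
  | Sum.inr z => att z

/-- Free reachability in the lift projects to wired reachability in `V`. [this work] -/
theorem reachable_of_liftGraph_reachable {x y : V ⊕ Z}
    (h : (openGraph (liftCfg a att ω) ⊔ wired ∅).Reachable x y) :
    (openGraph ω ⊔ wired (gadgetBlock a att)).Reachable (projV a x) (projV a y) := by
  -- one step
  have step : ∀ (u : V) (z : Z), s(Sum.inl u, Sum.inr z) ∈ liftCfg a att ω →
      (openGraph ω ⊔ wired (gadgetBlock a att)).Reachable u a := by
    intro u z hm
    rcases (inl_inr_mem_liftCfg_iff a att ω u z).1 hm with rfl | rfl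
    · exact Reachable.refl _
    · by_cases h : att z = a
      · rw [h]
      · exact Adj.reachable ((sup_adj _ _ _ _).2 (Or.inr ((wired_adj _ _ _).2
          ⟨h, Set.mem_insert_of_mem _ (Set.mem_range_self z), Set.mem_insert _ _⟩)))
  rw [reachable_iff_reflTransGen] at h
  induction h with
  | refl => exact Reachable.refl _
  | @tail x' y' _ hxy ih =>
    refine ih.trans ?_
    obtain ⟨hm, hne⟩ := (liftGraph_adj a att ω x' y').1 hxy
    cases x' with
    | inl u => cases y' with
      | inl v =>
        exact Adj.reachable ((sup_adj _ _ _ _).2 (Or.inl ((openGraph_adj ω u v).2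
          ⟨(inl_inl_mem_liftCfg_iff a att ω u v).1 hm, fun h' => hne (by rw [h'])⟩)))
      | inr z => exact step u z hm
    | inr z => cases y' with
      | inl u => rw [Sym2.eq_swap] at hm; exact (step u z hm).symm
      | inr z' => exact absurd hm (inr_inr_not_mem_liftCfg a att ω z z')

/-- **The components of the lift are the `B`-wired components of `ω`** (an explicit equivalence). [this work] -/
def liftComponentEquiv :
    (openGraph ω ⊔ wired (gadgetBlock a att)).ConnectedComponent ≃
      (openGraph (liftCfg a att ω) ⊔ wired ∅).ConnectedComponent where
  toFun := ConnectedComponent.lift (fun v => (openGraph (liftCfg a att ω) ⊔ wired ∅).connectedComponentMk (Sum.inl v))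
    fun _ _ p _ => ConnectedComponent.sound (liftGraph_reachable_of_reachable a att ω p.reachable)
  invFun := ConnectedComponent.lift (fun x => (openGraph ω ⊔ wired (gadgetBlock a att)).connectedComponentMk (projV a x))
    fun _ _ p _ => ConnectedComponent.sound (reachable_of_liftGraph_reachable a att ω p.reachable)
  left_inv := by
    refine ConnectedComponent.ind fun v => ?_
    simp only [ConnectedComponent.lift_mk, projV]
  right_inv := by
    refine ConnectedComponent.ind fun x => ?_
    simp only [ConnectedComponent.lift_mk]
    cases x with
    | inl v => rfl
    | inr z =>
      exact ConnectedComponent.sound (Adj.reachable ((liftGraph_adj a att ω _ _).2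
        ⟨(inl_inr_mem_liftCfg_iff a att ω a z).2 (Or.inl rfl), Sum.inl_ne_inr⟩))

/-- **Cluster count of the lift**: `k(ι(ω) ∪ Γ) = k^B(ω)`, `B = {a} ∪ att(Z)`. [this work] -/
theorem clusterCount_liftCfg : clusterCount (liftCfg a att ω) ∅ = clusterCount ω (gadgetBlock a att) := by
  unfold clusterCount
  exact (Nat.card_congr (liftComponentEquiv a att ω)).symm

end Clusters

end ApexWired

end PivotalBHK

end Summit.CriticalPhenomena.PercolationContinuityZ3.Theorems

end
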